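import Literature.NumberTheory.LFunctions.NoRealZeroCertificateReplay
import HarnessLib

/-!
# Kernel replay of the Lu–Zaman–Zhao certificates: the compiled-evaluation variant

Topic `Literature/NumberTheory/LFunctions`. The checker of `NoRealZeroCertificateReplay.lean`
(`LuZamanZhao2026.Replay.checkRange`, sound by `certifiedRange_of_checkRange`) is written for the
KERNEL (`decide +kernel`): literal verified tables, Euler's criterion by two large `Nat.pow`. This
file gives an extensionally EQUAL checker tuned for COMPILED evaluation (`native_decide`, i.e.
modulo the axiom `Lean.ofReduceBool` — the tree's precedent: `MertensCertificate/Chunk*`,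
`LiouvilleSieve/Chunk*`), for ranges that are out of the kernel's reach (the "heavy" discriminants
whose certificates need 10⁴–10⁷ primes):

* `powMod` — modular exponentiation by repeated squaring (`powMod_eq : powMod a e m = a^e mod m`),
  `eulerCodeF = eulerCode` (`eulerCodeF_eq`), and the chain `pickF`, `rowSearchF`, `rowOKF`,
  `dOKF`, `walkF` with `pickF_eq`, `rowSearchF_eq`, `rowOKF_eq`, `dOKF_eq`, `walkF_eq` (pointwise
  equal to the kernel versions, so every soundness theorem transfers);
* `ctable R pmax` — the prime table COMPUTED (primes by trial division, entries by `prow2` = `prow`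
  with one argument halving in `exp`, valid for all `p < 3·10¹²`, clamped
  to `ℕ`) instead of a literal, with the abstract validity proof `ctable_valid : TableValid (ctable R pmax)`
  (no evaluation involved: `prow_sound`, `prime_of_isPrimeC`, sortedness from `List.range`);
* `checkRangeC pmax Q₀ Q₁ X` and **`certifiedRange_of_checkRangeC`**:
  `checkRangeC pmax Q₀ Q₁ X = true → CertifiedRange (1/5) Q₀ Q₁ X`; `checkOneC` likewise.

Nothing is evaluated here. A file that proves `checkRangeC … = true` by `native_decide` carries the
extra axiom and must say so; the kernel files (`…Range*.lean`) remain axiom-free.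

## References

* W. Lu, A. Zaman, K. Zhao, *Dirichlet L-functions of quadratic characters have no exceptional
  zeros for moduli up to 10¹⁰*, Math. Comp. (2026), arXiv:2602.03626, §2.1–§3. [LuZamanZhao2026]
* H. L. Montgomery, R. C. Vaughan, *Multiplicative Number Theory I*, CUP 2007, §9.3.
  [MontgomeryVaughan2007]
-/

open Finset Real

namespace Literature.NumberTheory.LFunctions
namespace LuZamanZhao2026
namespace Replay

open Literature.Analysis.ValidatedNumerics Literature.Analysis.ValidatedNumerics.NumericsMP
open Literature.Barriers.RiemannHypothesis (IsFundamentalDiscriminant)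

/-! ## Modular exponentiation by repeated squaring -/

/-- `acc · a^e (mod m)` by binary exponentiation, `fuel` halvings of `e`. [folklore] -/
def powModAux (m : ℕ) : ℕ → ℕ → ℕ → ℕ → ℕ
  | 0, _, _, acc => acc
  | fuel + 1, a, e, acc =>
    if e = 0 then acc
    else powModAux m fuel (a * a % m) (e / 2) (if e % 2 = 1 then acc * a % m else acc)

/-- `a^e mod m` (for `e < 2^64`). [folklore] -/
def powMod (a e m : ℕ) : ℕ := powModAux m 64 (a % m) e (1 % m) % m

/-- The congruence invariant of `powModAux`. [folklore] -/
private theorem powModAux_mod (m : ℕ) : ∀ (fuel a e acc : ℕ), e < 2 ^ fuel →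
    powModAux m fuel a e acc % m = acc * a ^ e % m
  | 0, a, e, acc, he => by
    have : e = 0 := by simpa using he
    subst this
    simp [powModAux]
  | fuel + 1, a, e, acc, he => by
    unfold powModAux
    by_cases h0 : e = 0
    · subst h0; simp
    rw [if_neg h0]
    have he2 : e / 2 < 2 ^ fuel := by
      rw [pow_succ] at he; omega
    rw [powModAux_mod m fuel _ _ _ he2]
    -- `acc' (a² mod m)^(e/2) ≡ acc a^e`
    have key : ∀ acc' : ℕ, acc' * (a * a % m) ^ (e / 2) % m = acc' * a ^ (2 * (e / 2)) % m := by
      intro acc'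
      rw [Nat.mul_mod, Nat.pow_mod, Nat.mod_mod, ← Nat.pow_mod, ← Nat.mul_mod, pow_mul, sq]
    by_cases h1 : e % 2 = 1
    · rw [if_pos h1, key]
      have he' : e = 2 * (e / 2) + 1 := by omega
      conv_rhs => rw [he', pow_succ]
      rw [Nat.mul_mod (acc * a % m), Nat.mod_mod, ← Nat.mul_mod]
      congr 1; ring
    · rw [if_neg h1, key]
      have he' : e = 2 * (e / 2) := by omega
      conv_rhs => rw [he']

/-- **`powMod a e m = a^e mod m`** for `e < 2^64` (repeated squaring, as used for Euler's criterion). [cite: MontgomeryVaughan2007, §9.3] -/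
theorem powMod_eq {a e m : ℕ} (he : e < 2 ^ 64) : powMod a e m = a ^ e % m := by
  unfold powMod
  rw [powModAux_mod m 64 _ _ _ he, Nat.mul_mod, Nat.mod_mod, ← Nat.pow_mod, ← Nat.mul_mod, one_mul]

/-- The primes `≤ n`, by trial division (`isPrimeC`). [folklore] -/
def primesUpTo (n : ℕ) : List ℕ := (List.range (n + 1)).filter fun k => isPrimeC k

/-! ## The compiled-evaluation variants of the checker, equal to the kernel ones -/

/-- Euler's criterion code by `powMod` (for compiled evaluation). [cite: MontgomeryVaughan2007, §9.3] -/
def eulerCodeF (a p : ℕ) : ℕ := if p < 2 ^ 64 then powMod a (p / 2) p else eulerCode a p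

/-- `eulerCodeF = eulerCode`. [cite: MontgomeryVaughan2007, §9.3] -/
theorem eulerCodeF_eq : eulerCodeF = eulerCode := by
  funext a p
  unfold eulerCodeF
  split_ifs with h
  · rw [eulerCode_eq, powMod_eq (by omega)]
  · rfl

/-- `pick` with `eulerCodeF`. [cite: MontgomeryVaughan2007, §9.3] -/
def pickF (neg : Bool) (Dabs : ℕ) (e : PRow) : ℕ :=
  let t := Dabs % e.p
  if e.p = 2 then
    (if t = 0 then e.tZero else if Dabs % 8 = 1 ∨ Dabs % 8 = 7 then e.tPlus else e.tMinus)
  else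
    let a := if neg then (if t = 0 then 0 else e.p - t) else t
    let c := eulerCodeF a e.p
    if c = 1 then e.tPlus else if c = 0 then e.tZero else e.tMinus

/-- `pickF = pick`. [cite: MontgomeryVaughan2007, §9.3] -/
theorem pickF_eq : pickF = pick := by
  funext neg Dabs e
  simp only [pickF, pick, eulerCodeF_eq]

/-- `rowSearch` with `pickF`. [cite: LuZamanZhao2026, §2.1 and (2.5)] -/
def rowSearchF (neg : Bool) (Dabs : ℕ) (h : ℤ) : List PRow → ℕ → Bool
  | [], _ => false
  | e :: T, acc =>
    match acc + pickF neg Dabs e with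
    | 0 => rowSearchF neg Dabs h T 0
    | k + 1 => if h < ((k + 1 : ℕ) : ℤ) then true else rowSearchF neg Dabs h T (k + 1)

/-- `rowSearchF = rowSearch`. [cite: LuZamanZhao2026, §2.1 and (2.5)] -/
theorem rowSearchF_eq (neg : Bool) (Dabs : ℕ) (h : ℤ) (T : List PRow) :
    ∀ acc : ℕ, rowSearchF neg Dabs h T acc = rowSearch neg Dabs h T acc := by
  induction T with
  | nil => intro acc; simp [rowSearchF, rowSearch]
  | cons e T ih =>
    intro acc
    simp only [rowSearchF, rowSearch, pickF_eq, ih]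
    all_goals (generalize acc + pick neg Dabs e = s; cases s <;> rfl)

/-- `rowOK` with `rowSearchF`. [cite: LuZamanZhao2026, (2.5)] -/
def rowOKF (R : MI) (T : List PRow) (neg : Bool) (Dabs : ℕ) : Bool :=
  match rhsHi R Dabs with
  | some h => rowSearchF neg Dabs h T 0
  | none => false

/-- `rowOKF = rowOK`. [cite: LuZamanZhao2026, (2.5)] -/
theorem rowOKF_eq (R : MI) (T : List PRow) (neg : Bool) (Dabs : ℕ) :
    rowOKF R T neg Dabs = rowOK R T neg Dabs := by
  have hf : rowSearchF = rowSearch := by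
    funext neg Dabs h T acc; exact rowSearchF_eq neg Dabs h T acc
  simp only [rowOKF, rowOK, hf]
  all_goals (generalize rhsHi R Dabs = o; cases o <;> rfl)

/-- `dOK` with `rowOKF`. [cite: LuZamanZhao2026, §2.1–§3] -/
def dOKF (R : MI) (T : List PRow) (X : List ℤ) (neg : Bool) (m : ℕ) : Bool :=
  nonfundC T (sgnD neg m) || memZ (sgnD neg m) X || rowOKF R T neg m

/-- `dOKF = dOK`. [cite: LuZamanZhao2026, §2.1–§3] -/
theorem dOKF_eq (R : MI) (T : List PRow) (X : List ℤ) (neg : Bool) (m : ℕ) :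
    dOKF R T X neg m = dOK R T X neg m := by
  unfold dOKF dOK; rw [rowOKF_eq]

/-- `walk` with `dOKF`. [folklore] -/
def walkF (R : MI) (T : List PRow) (X : List ℤ) : ℕ → ℕ → Bool
  | 0, _ => true
  | fuel + 1, m =>
    dOKF R T X false m && dOKF R T X true m &&
      (match m + 1 with
        | 0 => false
        | k + 1 => walkF R T X fuel (k + 1))

/-- `walkF = walk`. [folklore] -/
private theorem walkF_eq (R : MI) (T : List PRow) (X : List ℤ) :
    ∀ fuel : ℕ, walkF R T X fuel = walk R T X fuel := by
  have hd : dOKF = dOK := by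
    funext R T X neg m; exact dOKF_eq R T X neg m
  intro fuel
  induction fuel with
  | zero => funext m; simp [walkF, walk]
  | succ fuel ih =>
    funext m
    simp only [walkF, walk, hd, ih]

/-! ## The computed table and its validity -/

/-- The three term enclosures at `p` for the COMPUTED table: as `prow`, but the exponential
`exp (r log p)` is evaluated with one argument halving (`MI.exp … 1`), so that it is defined for all
`p < e^{2/r} ≈ 3·10¹²` (the kernel's `prow` stops at `r log p ≤ 1`, i.e. `p ≤ 1.78·10⁶`).
[cite: LuZamanZhao2026, (2.3)] -/
def prow2 (R : MI) (p : ℕ) : Option (MI × MI × MI) :=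
  match MI.logNat2 SC KL p with
  | none => none
  | some L =>
    match MI.exp SC KE 1 (MI.mul SC R L) with
    | none => none
    | some E =>
      let U := E.mulInt p
      let Um1 := U.sub (MI.ofInt SC 1)
      match MI.divPos SC (L.mulInt 2) Um1, MI.divPos SC L Um1,
        MI.divPos SC (L.mulInt 2) ((MI.sqr SC U).sub (MI.ofInt SC 1)) with
      | some A, some B, some C => some (A, B, C)
      | _, _, _ => none

/-- `0 < SC`. [folklore] -/
private theorem SC_pos' : 0 < SC := by unfold SC; positivity

/-- The enclosures of `prow2` are correct. [cite: LuZamanZhao2026, (2.3)] -/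
theorem prow2_sound {R : MI} (hR : MI.mem SC (rOf 1.6) R) {p : ℕ} (hp : 2 ≤ p) {A B C : MI}
    (h : prow2 R p = some (A, B, C)) :
    MI.mem SC (2 * Real.log p / ((p : ℝ) ^ sig - 1)) A ∧
      MI.mem SC (Real.log p / ((p : ℝ) ^ sig - 1)) B ∧
      MI.mem SC (2 * Real.log p / (((p : ℝ) ^ sig) ^ 2 - 1)) C := by
  unfold prow2 at h
  split at h
  · simp at h
  rename_i L hL
  split at h
  · simp at h
  rename_i E hE
  simp only at h
  split at h
  · rename_i A' B' C' hA hB hC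
    simp only [Option.some.injEq, Prod.mk.injEq] at h
    obtain ⟨rfl, rfl, rfl⟩ := h
    have hlog := MI.mem_logNat2 SC_pos' hL
    have hexp := MI.mem_exp SC_pos' hE (MI.mem_mul SC_pos' hR hlog)
    have hp0 : (0 : ℝ) < p := by exact_mod_cast (show 0 < p by omega)
    have hU : MI.mem SC ((p : ℝ) ^ sig) (E.mulInt p) := by
      have := MI.mem_mulInt hexp (p : ℤ)
      convert this using 1
      rw [sig, add_comm, Real.rpow_add hp0, Real.rpow_one, Real.rpow_def_of_pos hp0]
      push_cast
      ring_nf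
    have h1 := MI.mem_ofInt SC (1 : ℤ)
    have hUm1 : MI.mem SC ((p : ℝ) ^ sig - 1) ((E.mulInt p).sub (MI.ofInt SC 1)) := by
      simpa using MI.mem_sub hU h1
    have hU2 : MI.mem SC (((p : ℝ) ^ sig) ^ 2 - 1) ((MI.sqr SC (E.mulInt p)).sub (MI.ofInt SC 1)) := by
      simpa using MI.mem_sub (MI.mem_sqr SC_pos' hU) h1
    have hL2 : MI.mem SC (2 * Real.log p) (L.mulInt 2) := by
      simpa [mul_comm] using MI.mem_mulInt hlog (2 : ℤ)
    exact ⟨MI.mem_divPos SC_pos' hA hL2 hUm1, MI.mem_divPos SC_pos' hB hlog hUm1,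
      MI.mem_divPos SC_pos' hC hL2 hU2⟩
  · simp at h


/-- One computed table entry at a prime `p`: the three lower bounds of `prow2`, clamped to `ℕ`.
[cite: LuZamanZhao2026, (2.3)] -/
def centry (R : MI) (p : ℕ) : Option PRow :=
  match prow2 R p with
  | some (A, B, C) => some ⟨p, A.lo.toNat, B.lo.toNat, C.lo.toNat⟩
  | none => none

/-- **The computed prime table** up to `pmax` (primes by trial division, entries by `prow`).
[cite: LuZamanZhao2026, §2.2 and (2.3)] -/
def ctable (R : MI) (pmax : ℕ) : List PRow := (primesUpTo pmax).filterMap (centry R)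

/-- `centry` keeps the prime. [folklore] -/
private theorem centry_p {R : MI} {p : ℕ} {e : PRow} (h : centry R p = some e) : e.p = p := by
  unfold centry at h
  split at h
  · simp only [Option.some.injEq] at h; rw [← h]
  · simp at h

/-- Clamping a scaled lower bound to `ℕ` keeps it a lower bound of a nonnegative quantity. [folklore] -/
private theorem toNat_le_of_le {z : ℤ} {y : ℝ} (h : (z : ℝ) ≤ y) (hy : 0 ≤ y) : ((z.toNat : ℕ) : ℝ) ≤ y := by
  by_cases hz : 0 ≤ z
  · have : ((z.toNat : ℕ) : ℤ) = z := Int.toNat_of_nonneg hz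
    calc ((z.toNat : ℕ) : ℝ) = (((z.toNat : ℕ) : ℤ) : ℝ) := by push_cast; rfl
      _ = (z : ℝ) := by rw [this]
      _ ≤ y := h
  · have : z.toNat = 0 := Int.toNat_of_nonpos (by omega)
    rw [this]; simpa using hy

/-- The primes produced by `primesUpTo` are prime. [folklore] -/
private theorem prime_of_mem_primesUpTo {pmax p : ℕ} (h : p ∈ primesUpTo pmax) : p.Prime := by
  unfold primesUpTo at h
  rw [List.mem_filter] at h
  -- `isPrimeC p = true`
  have hc : isPrimeC p = true := by simpa using h.2
  -- re-prove soundness of trial division locally (the library lemma is private there)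
  unfold isPrimeC at hc
  rw [Bool.and_eq_true, decide_eq_true_eq] at hc
  rw [Nat.prime_def_le_sqrt]
  refine ⟨hc.1, fun m hm2 hms => ?_⟩
  have hmm : m * m ≤ p := Nat.le_sqrt.1 hms
  -- the invariant of `noDivFrom`
  have key : ∀ fuel d : ℕ, noDivFrom p fuel d = true → ∀ m, d ≤ m → m * m ≤ p → ¬ m ∣ p := by
    intro fuel
    induction fuel with
    | zero => intro d h; simp [noDivFrom] at h
    | succ fuel ih =>
      intro d h m hdm hmm hdvd
      unfold noDivFrom at h
      by_cases h1 : p < d * d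
      · have : d * d ≤ m * m := Nat.mul_le_mul hdm hdm
        omega
      rw [if_neg h1] at h
      by_cases h2 : p % d = 0
      · rw [if_pos h2] at h; exact Bool.false_ne_true h
      rw [if_neg h2] at h
      rcases Nat.eq_or_lt_of_le hdm with rfl | hlt
      · exact h2 (Nat.mod_eq_zero_of_dvd hdvd)
      · exact ih (d + 1) h m hlt hmm hdvd
  exact key p 2 hc.2 m hm2 hmm

/-- `2 log p/(p^σ − 1) ≥ 0` etc.: the three summand values are nonnegative for `p ≥ 2`. [cite: LuZamanZhao2026, (2.3)] -/
private theorem bounds_nonneg {p : ℕ} (hp : 2 ≤ p) :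
    0 ≤ 2 * Real.log p / ((p : ℝ) ^ sig - 1) ∧ 0 ≤ Real.log p / ((p : ℝ) ^ sig - 1) ∧
      0 ≤ 2 * Real.log p / (((p : ℝ) ^ sig) ^ 2 - 1) := by
  have hlog : 0 ≤ Real.log p := Real.log_nonneg (by exact_mod_cast (show 1 ≤ p by omega))
  have hp' : (2 : ℝ) ≤ p := by exact_mod_cast hp
  have hu : (2 : ℝ) ≤ (p : ℝ) ^ sig :=
    calc (2 : ℝ) = 2 ^ (1 : ℝ) := by simp
      _ ≤ (p : ℝ) ^ (1 : ℝ) := Real.rpow_le_rpow (by norm_num) hp' (by norm_num)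
      _ ≤ (p : ℝ) ^ sig := Real.rpow_le_rpow_of_exponent_le (by linarith) one_lt_sig.le
  refine ⟨div_nonneg (by linarith) (by linarith), div_nonneg hlog (by linarith),
    div_nonneg (by linarith) (by nlinarith)⟩

/-- Every computed entry is valid. [cite: LuZamanZhao2026, §2.2 and (2.3)] -/
private theorem entryValid_of_centry {R : MI} (hR : MI.mem SC (rOf 1.6) R) {p : ℕ} (hp : p.Prime) {e : PRow}
    (h : centry R p = some e) : EntryValid e := by
  unfold centry at h
  split at h
  · rename_i A B C hABC
    simp only [Option.some.injEq] at h
    subst h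
    obtain ⟨hA, hB, hC⟩ := prow2_sound hR hp.two_le hABC
    obtain ⟨n1, n2, n3⟩ := bounds_nonneg hp.two_le
    have hS : (0 : ℝ) ≤ SC := by exact_mod_cast (show 0 < SC by unfold SC; positivity).le
    exact ⟨hp, toNat_le_of_le hA.1 (mul_nonneg n1 hS), toNat_le_of_le hB.1 (mul_nonneg n2 hS),
      toNat_le_of_le hC.1 (mul_nonneg n3 hS)⟩
  · simp at h

/-- The primes of a `filterMap` that keeps its argument form a sublist. [folklore] -/
private theorem map_filterMap_sublist {R : MI} : ∀ (l : List ℕ), ((l.filterMap (centry R)).map PRow.p).Sublist l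
  | [] => by simp
  | p :: l => by
    rw [List.filterMap_cons]
    cases hc : centry R p with
    | none => exact (map_filterMap_sublist l).cons p
    | some e =>
      rw [List.map_cons, centry_p hc]
      exact (map_filterMap_sublist l).cons_cons p

/-- **The computed table is valid.** [cite: LuZamanZhao2026, §2.2 and (2.3)] -/
theorem ctable_valid {R : MI} (hR : rI = some R) (pmax : ℕ) : TableValid (ctable R pmax) := by
  refine ⟨fun e he => ?_, ?_⟩
  · unfold ctable at he
    rw [List.mem_filterMap] at he
    obtain ⟨p, hp, hpe⟩ := he
    exact entryValid_of_centry (mem_rI hR) (prime_of_mem_primesUpTo hp) hpe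
  · have h1 : ((ctable R pmax).map PRow.p).Sublist (primesUpTo pmax) := map_filterMap_sublist _
    have h2 : (primesUpTo pmax).Sublist (List.range (pmax + 1)) := by
      unfold primesUpTo; exact List.filter_sublist
    exact (List.pairwise_lt_range).sublist (h1.trans h2)

/-! ## The compiled-evaluation checkers and their soundness -/

/-- **Range checker over the computed table** (for `native_decide`): table to `pmax`, every `d`
with `Q₀ < |d| ≤ Q₁` certified, non-fundamental, or in `X`. [cite: LuZamanZhao2026, §2.1–§3] -/
def checkRangeC (pmax Q0 Q1 : ℕ) (X : List ℤ) : Bool :=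
  match rI with
  | none => false
  | some R => walkF R (ctable R pmax) X (Q1 - Q0) (Q0 + 1)

/-- **Soundness of `checkRangeC`.** [cite: LuZamanZhao2026, §2.1–§3] -/
theorem certifiedRange_of_checkRangeC {pmax Q0 Q1 : ℕ} {X : List ℤ} (h : checkRangeC pmax Q0 Q1 X = true) :
    CertifiedRange (1 / 5) Q0 Q1 X := by
  unfold checkRangeC at h
  split at h
  · exact absurd h Bool.false_ne_true
  rename_i R hR
  rw [walkF_eq R (ctable R pmax) X (Q1 - Q0)] at h
  have h' : checkRange (ctable R pmax) Q0 Q1 X = true := by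
    unfold checkRange; rw [hR]; exact h
  exact certifiedRange_of_checkRange (ctable_valid hR pmax) h'

/-- **Single-discriminant checker over the computed table.** [cite: LuZamanZhao2026, §2.1–§3] -/
def checkOneC (pmax : ℕ) (neg : Bool) (Dabs : ℕ) : Bool :=
  match rI with
  | none => false
  | some R => rowOKF R (ctable R pmax) neg Dabs

/-- **Soundness of `checkOneC`.** [cite: LuZamanZhao2026, §2.1–§3] -/
theorem certifiedAt_of_checkOneC {pmax : ℕ} {neg : Bool} {Dabs : ℕ} (h : checkOneC pmax neg Dabs = true) :
    CertifiedAt (1 / 5) (sgnD neg Dabs) := by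
  unfold checkOneC at h
  split at h
  · exact absurd h Bool.false_ne_true
  rename_i R hR
  rw [rowOKF_eq] at h
  have h' : checkOne (ctable R pmax) neg Dabs = true := by
    unfold checkOne; rw [hR]; exact h
  exact certifiedAt_of_checkOne (ctable_valid hR pmax) h'

/-- **List checker over the computed table** (for the few "deep" discriminants, sharing ONE long
table): every `(neg, Dabs)` in the list is certified. [cite: LuZamanZhao2026, §2.1–§3] -/
def checkListC (pmax : ℕ) (ds : List (Bool × ℕ)) : Bool :=
  match rI with
  | none => false
  | some R =>
    let T := ctable R pmax
    ds.all fun x => rowOKF R T x.1 x.2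

/-- **Soundness of `checkListC`.** [cite: LuZamanZhao2026, §2.1–§3] -/
theorem certifiedAt_of_checkListC {pmax : ℕ} {ds : List (Bool × ℕ)} (h : checkListC pmax ds = true) :
    ∀ x ∈ ds, CertifiedAt (1 / 5) (sgnD x.1 x.2) := by
  unfold checkListC at h
  split at h
  · exact absurd h Bool.false_ne_true
  rename_i R hR
  intro x hx
  rw [List.all_eq_true] at h
  have hx' := h x hx
  simp only [rowOKF_eq] at hx'
  exact certifiedAt_of_rowOK (mem_rI hR) (ctable_valid hR pmax) hx'

/-- Discharging an exception list: a certified range whose exceptions are all in a certified list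
has no exceptions left. [cite: LuZamanZhao2026, §2.1–§3] -/
theorem CertifiedRange.of_checkListC {Q0 Q1 pmax : ℕ} {X : List ℤ} {ds : List (Bool × ℕ)}
    (h : CertifiedRange (1 / 5) Q0 Q1 X) (hl : checkListC pmax ds = true)
    (hX : ∀ D ∈ X, ∃ x ∈ ds, sgnD x.1 x.2 = D) : CertifiedRange (1 / 5) Q0 Q1 [] := by
  refine h.of_except fun D hD _ => ?_
  obtain ⟨x, hx, rfl⟩ := hX D hD
  exact certifiedAt_of_checkListC hl x hx

end Replay
end LuZamanZhao2026
end Literature.NumberTheory.LFunctions
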